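import Summits.NavierStokesRegularity.FunctionalMining.TopEigDanskinCurve
import Summits.NavierStokesRegularity.FunctionalMining.TopEigHeatDanskin
import Summits.NavierStokesRegularity.FunctionalMining.StrainTensorTransport
import HarnessLib

/-!
# FunctionalMining — the exact ONE-SIDED production rate of the `λ₁` moment along smooth evolutions

Search for candidate a priori estimates; no regularity claim. Cell `pub-nsfunc`, prove seat
(gen 21). The cell's rows `ES.lam1.q` / `ES.neglam3.q` carry the NON-SMOOTH spectral weight
`S ↦ λ₁(S)^q`: along an evolution `s ↦ u(s)` the functional `Φ_q(u(s)) = ∫ (λ₁⁺)^q(S(u(s)))` need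
not be differentiable (the one-sided derivatives differ where `λ₁ = λ₂ > 0` is split at positive
measure, `TopEigHeatCoercive.lean`), which is why the tree's rate statements for these rows are in
supremum / derivative-value form. Danskin's formula (`TopEigDanskin`, `TopEigDanskinCurve`) gives the
EXACT RIGHT DERIVATIVE, for every jointly smooth family of divergence-free fields:

* **`TopEig.hasDerivWithinAt_topEigMoment_spaceTime`** — for `u` jointly smooth on `[a, b] × T^d`
  with divergence-free slices, `q ≥ 1`, `t ∈ [a, b)`:
  `d⁺/ds|_{s=t} Φ_q(u(s)) = ∫ q λ₁^{q−1} μ(S(u(t)); Ṡ(t)) dx`, `Ṡ = ∂ₜ S(u(·))` (`Torus.timeDerivWithin`);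
  dominated convergence with the mean value inequality in time and the Lipschitz bounds for `λ` and
  `r ↦ r^q` (`TopEig.abs_rpow_sub_rpow_le`); the LEFT derivative and the differentiability criterion
  are in the companion file `TopEigProductionReverse.lean` (time reversal);
* **`TopEig.hasDerivWithinAt_topEigMoment_navierStokes`** (`_Icc`: the shape of `HasInitialRate`) —
  along a classical solution of forced Navier–Stokes the strain equation
  (`StrainTensor.timeDerivWithin_strainFlat_eq`, Majda–Bertozzi (1.29) symmetrised) gives the density
  `q λ₁^{q−1} μ(S; νΔS − Π + S(f) − N − Σₖ uₖ ∂ₖS)` — exact, one-sided, convex but NOT additive in the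
  forcing terms (`μ(S; M + M') ≤ μ(S; M) + μ(S; M')`).

Nothing here is an estimate: it is the exact symbolic `dF/dt⁺` of the `λ₁` rows. [ours; folklore calculus]
-/

noncomputable section

open MeasureTheory Set Filter Topology
open scoped ContDiff

namespace Summit.NavierStokesRegularity.FunctionalMining

open Literature.Analysis.FunctionSpaces Literature.Analysis.FluidPDE

namespace TopEig

variable {d : Type*} [Fintype d] [DecidableEq d] [Nonempty d]

/-! ## 1. The power `r ↦ r^q` is Lipschitz on bounded subsets of `[0, ∞)` -/

omit [Fintype d] [DecidableEq d] [Nonempty d] in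
/-- `|a^q − b^q| ≤ q Λ^{q−1} |a − b|` for `0 ≤ a, b ≤ Λ` and `q ≥ 1` (mean value theorem).
[folklore] -/
theorem abs_rpow_sub_rpow_le {a b Λ q : ℝ} (hq : 1 ≤ q) (ha : 0 ≤ a) (hb : 0 ≤ b) (haΛ : a ≤ Λ)
    (hbΛ : b ≤ Λ) : |a ^ q - b ^ q| ≤ q * Λ ^ (q - 1) * |a - b| := by
  -- the one-sided statement for `y < x`
  have key : ∀ x y : ℝ, 0 ≤ y → y < x → x ≤ Λ → x ^ q - y ^ q ≤ q * Λ ^ (q - 1) * (x - y) := by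
    intro x y hy hyx hxΛ
    have hcont : ContinuousOn (fun r : ℝ => r ^ q) (Icc y x) :=
      (Real.continuous_rpow_const (by linarith)).continuousOn
    have hder : ∀ r ∈ Ioo y x, HasDerivAt (fun r : ℝ => r ^ q) (q * r ^ (q - 1)) r :=
      fun r _ => Real.hasDerivAt_rpow_const (Or.inr hq)
    obtain ⟨c, hc, hslope⟩ := exists_hasDerivAt_eq_slope (fun r : ℝ => r ^ q)
      (fun r => q * r ^ (q - 1)) hyx hcont hder
    have hcΛ : c ^ (q - 1) ≤ Λ ^ (q - 1) :=
      Real.rpow_le_rpow (hy.trans hc.1.le) (hc.2.le.trans hxΛ) (by linarith)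
    have hxy : 0 < x - y := sub_pos.2 hyx
    have h1 : (x ^ q - y ^ q) / (x - y) ≤ q * Λ ^ (q - 1) := by
      rw [← hslope]; exact mul_le_mul_of_nonneg_left hcΛ (by linarith)
    rwa [div_le_iff₀ hxy] at h1
  rcases lt_trichotomy a b with h | rfl | h
  · have h1 := key b a ha h hbΛ
    have h2 : a ^ q ≤ b ^ q := Real.rpow_le_rpow ha h.le (by linarith)
    rw [abs_of_nonpos (sub_nonpos.2 h2), abs_of_nonpos (sub_nonpos.2 h.le)]
    linarith
  · simp
  · have h1 := key a b hb h haΛ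
    have h2 : b ^ q ≤ a ^ q := Real.rpow_le_rpow hb h.le (by linarith)
    rw [abs_of_nonneg (sub_nonneg.2 h2), abs_of_nonneg (sub_nonneg.2 h.le)]
    linarith

/-! ## 2. The right derivative of `Φ_q(u(s))` along a jointly smooth divergence-free family -/

/-- **Exact one-sided production rate of the `λ₁` moment.** Let `u : ℝ → (T^d → ℝ^d)` be jointly
smooth on `[a, b] × T^d` with divergence-free slices, `q ≥ 1`, `t ∈ [a, b)`, and let
`Ṡ = ∂ₜ(S ∘ u)` be the one-sided time derivative of the strain within `[a, b]`. Then
`s ↦ Φ_q(u(s)) = ∫(λ₁⁺)^q(S(u(s)))` has RIGHT derivative `∫ q λ₁^{q−1} μ(S(u(t)); Ṡ(t)) dx` at `t`.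
[ours] -/
theorem hasDerivWithinAt_topEigMoment_spaceTime {a b : ℝ} (hab : a < b)
    {u : ℝ → UnitAddTorus d → EuclideanSpace ℝ d} (hu : Torus.IsSmoothSpaceTimeOn (Icc a b) u)
    (hdiv : ∀ s ∈ Icc a b, Torus.IsDivFree (u s)) {q : ℝ} (hq : 1 ≤ q) {t : ℝ} (ht : t ∈ Ico a b) :
    HasDerivWithinAt (fun s => torusTopEigMoment q (u s))
      (∫ x, q * torusStrainTopEig (u t) x ^ (q - 1) *
        dirTopEig (StrainL4.strainFlat (u t) x)
          (Torus.timeDerivWithin (Icc a b) (fun s y => StrainL4.strainFlat (u s) y) t x))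
      (Set.Ioi t) t := by
  have hq0 : 0 ≤ q := by linarith
  have hU : UniqueDiffOn ℝ (Icc a b) := uniqueDiffOn_Icc hab
  have ht' : t ∈ Icc a b := ⟨ht.1, ht.2.le⟩
  have htb : t < b := ht.2
  -- the strain family and its one-sided time derivative
  obtain ⟨St, hSt⟩ : ∃ St : ℝ → UnitAddTorus d → EuclideanSpace ℝ (d × d),
      St = fun s y => StrainL4.strainFlat (u s) y := ⟨_, rfl⟩
  obtain ⟨Sd, hSd⟩ : ∃ Sd : ℝ → UnitAddTorus d → EuclideanSpace ℝ (d × d),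
      Sd = Torus.timeDerivWithin (Icc a b) St := ⟨_, rfl⟩
  have hS : Torus.IsSmoothSpaceTimeOn (Icc a b) St := by
    rw [hSt]; exact StrainTensor.isSmoothSpaceTimeOn_strainFlat hu hU
  have hSder : ∀ s ∈ Icc a b, ∀ x, HasDerivWithinAt (fun τ => St τ x) (Sd s x) (Icc a b) s :=
    fun s hs x => by rw [hSd]; exact hS.hasDerivWithinAt_slice hs x
  -- uniform bound on `Ṡ` near `t`
  have hSdt : Continuous (Sd t) := by rw [hSd]; exact (hS.isSmooth_timeDerivWithin hU ht').continuous
  obtain ⟨M, hM⟩ : ∃ M, ∀ x, ‖Sd t x‖ ≤ M := by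
    obtain ⟨M, hM⟩ := isCompact_univ.exists_bound_of_continuousOn hSdt.continuousOn
    exact ⟨M, fun x => hM x (mem_univ x)⟩
  have hbound : ∀ᶠ s in 𝓝[Icc a b] t, ∀ x, ‖Sd s x‖ ≤ M + 1 := by
    have h := hS.eventually_norm_timeDerivWithin_sub_lt hU ht' one_pos
    rw [← hSd] at h
    filter_upwards [h] with s hs x
    calc ‖Sd s x‖ ≤ ‖Sd t x‖ + ‖Sd s x - Sd t x‖ := norm_le_norm_add_norm_sub' _ _
      _ ≤ M + 1 := add_le_add (hM x) (hs x).le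
  obtain ⟨δ, hδ, hδC⟩ : ∃ δ > 0, ∀ s ∈ Icc a b, dist s t < δ → ∀ x, ‖Sd s x‖ ≤ M + 1 := by
    rcases Metric.mem_nhdsWithin_iff.1 hbound with ⟨δ, hδ, h⟩
    exact ⟨δ, hδ, fun s hs hst x => h ⟨hst, hs⟩ x⟩
  have hM1 : 0 ≤ M + 1 := by
    have := hδC t ht' (by simp [hδ]) (Classical.arbitrary _)
    exact (norm_nonneg _).trans this
  -- mean value inequality in time: `‖S(s,x) − S(t,x)‖ ≤ (M+1)(s − t)` for `t < s < t + δ`, `s ≤ b`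
  have hMVT : ∀ s ∈ Icc a b, dist s t < δ → ∀ x, ‖St s x - St t x‖ ≤ (M + 1) * ‖s - t‖ := by
    intro s hs hsδ x
    have hconv : Convex ℝ (Icc a b ∩ Metric.ball t δ) := (convex_Icc a b).inter (convex_ball t δ)
    exact hconv.norm_image_sub_le_of_norm_hasDerivWithin_le
      (f := (St · x)) (f' := fun τ => Sd τ x)
      (fun τ hτ => (hSder τ hτ.1 x).mono inter_subset_left)
      (fun τ hτ => hδC τ hτ.1 hτ.2 x) ⟨ht', Metric.mem_ball_self hδ⟩ ⟨hs, hsδ⟩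
  -- uniform bound `Λ` for `λ₁` along the family near `t`
  have hSt_cont : Continuous (St t) := by
    rw [hSt]; exact StrainL4.continuous_strainFlat (hu.isSmooth_slice ht')
  obtain ⟨Λ₀, hΛ₀⟩ : ∃ Λ₀, ∀ x, ‖St t x‖ ≤ Λ₀ := by
    obtain ⟨L, hL⟩ := isCompact_univ.exists_bound_of_continuousOn hSt_cont.continuousOn
    exact ⟨L, fun x => hL x (mem_univ x)⟩
  set Λ : ℝ := Λ₀ + (M + 1) * δ with hΛ
  have hlam_nn : ∀ s ∈ Icc a b, ∀ x, 0 ≤ lam (St s x) := fun s hs x => by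
    rw [hSt]; exact lam_strainFlat_nonneg (hu.isSmooth_slice hs) (hdiv s hs) x
  have hlam_le : ∀ s ∈ Icc a b, dist s t < δ → ∀ x, lam (St s x) ≤ Λ := by
    intro s hs hsδ x
    have h1 : lam (St s x) ≤ ‖St s x‖ := lam_le_norm _
    have h2 : ‖St s x‖ ≤ ‖St t x‖ + ‖St s x - St t x‖ := norm_le_norm_add_norm_sub' _ _
    have h3 := hMVT s hs hsδ x
    have h4 : ‖s - t‖ ≤ δ := by rw [← dist_eq_norm]; exact hsδ.le
    have h5 : (M + 1) * ‖s - t‖ ≤ (M + 1) * δ := mul_le_mul_of_nonneg_left h4 hM1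
    linarith [hΛ₀ x]
  -- the integrand and the moment
  obtain ⟨G, hG⟩ : ∃ G : ℝ → UnitAddTorus d → ℝ, G = fun s x => max (torusStrainTopEig (u s) x) 0 ^ q :=
    ⟨_, rfl⟩
  have hGdef : ∀ s, torusTopEigMoment q (u s) = ∫ x, G s x := fun s => by rw [hG]; rfl
  have hGlam : ∀ s ∈ Icc a b, ∀ x, G s x = lam (St s x) ^ q := by
    intro s hs x
    rw [hG, hSt]
    show max (torusStrainTopEig (u s) x) 0 ^ q = lam (StrainL4.strainFlat (u s) x) ^ q
    rw [← lam_strainFlat, max_eq_left (lam_strainFlat_nonneg (hu.isSmooth_slice hs) (hdiv s hs) x)]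
  have hGc : ∀ s ∈ Icc a b, Continuous (G s) := fun s hs => by
    rw [hG]
    exact ((continuous_torusStrainTopEig (hu.isSmooth_slice hs)).max continuous_const).rpow_const
      fun _ => Or.inr hq0
  obtain ⟨D, hD⟩ : ∃ D : UnitAddTorus d → ℝ, D = fun x => q * torusStrainTopEig (u t) x ^ (q - 1) *
      dirTopEig (StrainL4.strainFlat (u t) x)
        (Torus.timeDerivWithin (Icc a b) (fun s y => StrainL4.strainFlat (u s) y) t x) := ⟨_, rfl⟩
  -- pointwise right derivatives
  have hnhds : Ioc t b ∈ 𝓝[Ioi t] t := Ioc_mem_nhdsGT htb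
  have hptw : ∀ x, HasDerivWithinAt (fun s => G s x) (D x) (Ioi t) t := by
    intro x
    have hA : HasDerivWithinAt (fun s => St s x) (Sd t x) (Ioi t) t :=
      ((hSder t ht' x).mono (Ioc_subset_Icc_self.trans (Icc_subset_Icc ht.1 le_rfl))).mono_of_mem_nhdsWithin
        hnhds
    have h1 := hasDerivWithinAt_lam_comp_rpow hA hq
    have e1 : q * lam (St t x) ^ (q - 1) * dirTopEig (St t x) (Sd t x) = D x := by
      rw [hD, hSd, hSt, lam_strainFlat]
    rw [e1] at h1
    refine h1.congr_of_eventuallyEq ?_ (hGlam t ht' x)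
    filter_upwards [hnhds] with s hs
    exact hGlam s ⟨ht.1.trans hs.1.le, hs.2⟩ x
  -- dominated convergence for the difference quotients
  have h0 : t ∉ Ioi t := fun h => lt_irrefl t h
  have hmem : ∀ᶠ s in 𝓝[Ioi t] t, s ∈ Ioc t b ∧ dist s t < δ := by
    have h1 : ∀ᶠ s in 𝓝[Ioi t] t, dist s t < δ :=
      (Metric.tendsto_nhds.1 tendsto_id δ hδ).filter_mono nhdsWithin_le_nhds
    filter_upwards [hnhds, h1] with s hs hs' using ⟨hs, hs'⟩
  have hlim : Tendsto (fun s => ∫ x, (G s x - G t x) / (s - t)) (𝓝[Ioi t] t) (𝓝 (∫ x, D x)) := by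
    refine tendsto_integral_filter_of_dominated_convergence (fun _ => q * Λ ^ (q - 1) * (M + 1))
      ?_ ?_ (integrable_const _) ?_
    · filter_upwards [hmem] with s hs
      have hsI : s ∈ Icc a b := ⟨ht.1.trans hs.1.1.le, hs.1.2⟩
      exact (((hGc s hsI).sub (hGc t ht')).div_const (s - t)).aestronglyMeasurable
    · filter_upwards [hmem] with s hs
      have hsI : s ∈ Icc a b := ⟨ht.1.trans hs.1.1.le, hs.1.2⟩
      have hst : 0 < s - t := sub_pos.2 hs.1.1
      refine Eventually.of_forall fun x => ?_
      rw [Real.norm_eq_abs, abs_div, abs_of_pos hst, div_le_iff₀ hst, hGlam s hsI x, hGlam t ht' x]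
      have h1 := abs_rpow_sub_rpow_le hq (hlam_nn s hsI x) (hlam_nn t ht' x) (hlam_le s hsI hs.2 x)
        (hlam_le t ht' (by simp [hδ]) x)
      have h2 : |lam (St s x) - lam (St t x)| ≤ ‖St s x - St t x‖ := abs_lam_sub_lam_le _ _
      have h3 := hMVT s hsI hs.2 x
      rw [Real.norm_eq_abs, abs_of_pos hst] at h3
      have hK : 0 ≤ q * Λ ^ (q - 1) := by
        have hΛ0 : 0 ≤ Λ := (hlam_nn t ht' (Classical.arbitrary _)).trans
          (hlam_le t ht' (by simp [hδ]) _)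
        exact mul_nonneg hq0 (Real.rpow_nonneg hΛ0 _)
      calc |lam (St s x) ^ q - lam (St t x) ^ q|
          ≤ q * Λ ^ (q - 1) * |lam (St s x) - lam (St t x)| := h1
        _ ≤ q * Λ ^ (q - 1) * ((M + 1) * (s - t)) :=
            mul_le_mul_of_nonneg_left (h2.trans h3) hK
        _ = q * Λ ^ (q - 1) * (M + 1) * (s - t) := by ring
    · exact Eventually.of_forall fun x => by
        have h := (hasDerivWithinAt_iff_tendsto_slope' h0).1 (hptw x)
        refine h.congr' ?_
        filter_upwards [self_mem_nhdsWithin] with s _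
        rw [slope_def_field]
  rw [hasDerivWithinAt_iff_tendsto_slope' h0]
  have hDint : (∫ x, D x) = ∫ x, q * torusStrainTopEig (u t) x ^ (q - 1) *
      dirTopEig (StrainL4.strainFlat (u t) x)
        (Torus.timeDerivWithin (Icc a b) (fun s y => StrainL4.strainFlat (u s) y) t x) := by rw [hD]
  rw [← hDint]
  refine hlim.congr' ?_
  filter_upwards [hmem] with s hs
  have hsI : s ∈ Icc a b := ⟨ht.1.trans hs.1.1.le, hs.1.2⟩
  rw [slope_def_field, hGdef s, hGdef t, ← integral_sub (hGc s hsI).integrable_unitAddTorus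
    (hGc t ht').integrable_unitAddTorus, integral_div]

/-! ## 3. Along Navier–Stokes: the strain equation inside `μ` -/

/-- **Exact one-sided production of `∫(λ₁⁺)^q` along Navier–Stokes.** For a classical solution of
`∂ₜu + (u·∇)u = νΔu − ∇p + f`, `div u = 0` on `T^d × [a, b]` (`a < b`), real `q ≥ 1` and
`t ∈ [a, b)`: `s ↦ Φ_q(u(s))` has RIGHT derivative
`∫ q λ₁^{q−1} μ(S; νΔS − Π + S(f) − N − Σₖ uₖ ∂ₖS) dx` at `t`, with the strain-equation terms of
`StrainTensor.timeDerivWithin_strainFlat_eq` (`Π` the pressure Hessian vector `pressVec`, `N` the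
quadratic term `nonlinVec`). The functional `μ(S; ·)` is convex, positively homogeneous and
subadditive in the forcing, not additive. [ours; the strain equation is Majda–Bertozzi (1.29)] -/
theorem hasDerivWithinAt_topEigMoment_navierStokes {a b ν : ℝ} (hab : a < b)
    {f u : ℝ → UnitAddTorus d → EuclideanSpace ℝ d} {p : ℝ → UnitAddTorus d → ℝ}
    (h : Torus.IsClassicalNSSolutionOn (Icc a b) ν f u p) {q : ℝ} (hq : 1 ≤ q) {t : ℝ}
    (ht : t ∈ Ico a b) :
    HasDerivWithinAt (fun s => torusTopEigMoment q (u s))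
      (∫ x, q * torusStrainTopEig (u t) x ^ (q - 1) *
        dirTopEig (StrainL4.strainFlat (u t) x)
          (ν • Torus.laplacian (StrainL4.strainFlat (u t)) x - StrainTensor.pressVec (p t) x +
            StrainL4.strainFlat (f t) x - StrainTensor.nonlinVec (u t) x -
            ∑ k, u t x k • Torus.partialDeriv k (StrainL4.strainFlat (u t)) x))
      (Set.Ioi t) t := by
  have ht' : t ∈ Icc a b := ⟨ht.1, ht.2.le⟩
  have h1 := hasDerivWithinAt_topEigMoment_spaceTime hab h.smooth_velocity h.divFree hq ht
  refine h1.congr_deriv (integral_congr_ae (ae_of_all _ fun x => ?_))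
  show q * torusStrainTopEig (u t) x ^ (q - 1) * dirTopEig (StrainL4.strainFlat (u t) x)
      (Torus.timeDerivWithin (Icc a b) (fun s y => StrainL4.strainFlat (u s) y) t x) = _
  rw [StrainTensor.timeDerivWithin_strainFlat_eq h hab ht' x]

/-- The same at the initial time `a`, within `[a, b]` — the shape of the tree's `HasInitialRate`
clause `HasDerivWithinAt (fun s => F (u s)) _ (Icc a b) a`. [ours] -/
theorem hasDerivWithinAt_topEigMoment_navierStokes_Icc {a b ν : ℝ} (hab : a < b)
    {f u : ℝ → UnitAddTorus d → EuclideanSpace ℝ d} {p : ℝ → UnitAddTorus d → ℝ}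
    (h : Torus.IsClassicalNSSolutionOn (Icc a b) ν f u p) {q : ℝ} (hq : 1 ≤ q) :
    HasDerivWithinAt (fun s => torusTopEigMoment q (u s))
      (∫ x, q * torusStrainTopEig (u a) x ^ (q - 1) *
        dirTopEig (StrainL4.strainFlat (u a) x)
          (ν • Torus.laplacian (StrainL4.strainFlat (u a)) x - StrainTensor.pressVec (p a) x +
            StrainL4.strainFlat (f a) x - StrainTensor.nonlinVec (u a) x -
            ∑ k, u a x k • Torus.partialDeriv k (StrainL4.strainFlat (u a)) x))
      (Set.Icc a b) a :=
  ((hasDerivWithinAt_Ioi_iff_Ici.1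
    (hasDerivWithinAt_topEigMoment_navierStokes hab h hq ⟨le_rfl, hab⟩))).mono Icc_subset_Ici_self

end TopEig

end Summit.NavierStokesRegularity.FunctionalMining

end
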